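import Summits.QuantumFields.YangMills.Theorems.SwapVirialDeficitGnomonicHistorySpeed
import Summits.QuantumFields.YangMills.Theorems.SwapVirialDeficitBlowUpGnomonicEulerIdentity
import HarnessLib

/-!
# The σ-GLUED DEFICIT IN GNOMONIC COORDINATES `F̂_{a,ε}(η)` and its EULER DERIVATIVE `XF̂` (file B0 of the V2′ assembly of fcl-p3 g45's virial SPEC,
# memo2-24197-window v2 §2′; free-hands support of ⟨stmt-QuantumFields-24197⟩ `SwapVirialDeficit.SwapGluedStiffness`)

For a hub `a`, hemisphere signs `ε : GnoSign L`, sector `z` and character `χ`, the σ-glued deficit read in the gnomonic blow-up chart is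
`F̂ η := chartDeficit L z χ (blowUpPoint 1 (gnomonicPoint a ε η))`, `η ∈ GnoCoord L` (✓G0: `blowUpPoint t ∘ gnomonicPoint a ε = blowUpPoint 1 ∘ gnomonicPoint a ε ∘ eulerDilate t`),
and its EULER DERIVATIVE is the flow derivative `XF̂ η := d/ds|₀ F̂(eulerDilate eˢ η)`.
* §1 `gnoDeficit`, `gnoXDeficit` (two `def`s); `gnoDeficit_eulerDilate` (`F̂(eulerDilate t η) = chartDeficit (blowUpPoint t (gnomonicPoint a ε η))`),
  `gnoDeficit_nonneg`, `measurable_gnoDeficit`;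
* §2 ★ `hasDerivAt_gnoDeficit` — w2 g57's S-B ✓`Gnomonic.hasDerivAt_chartDeficit_gnomonic_le` restated: for `a ≠ 0` the flow derivative exists at `s = 0`, equals
  `XF̂ η`, and `|XF̂ η| ≤ 324·L⁴`; `hasDerivAt_gnoDeficit_flow` (every `s`, ✓`hasDerivAt_eulerFlow`); ★ `measurable_gnoXDeficit` (`XF̂` is the pointwise limit of
  measurable difference quotients, ✓`measurable_of_tendsto_metrizable`).
These are exactly the hypotheses of ✓`integral_eulerDeriv_mul_gnoDensity` (A2) for `g = e^{−bF̂}`; the virial identity itself is file B.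
HONEST LABEL: definitions and bookkeeping at fixed `L`; nothing about ⟨24197⟩ (window-uniform) or any rung is proved; the Yang–Mills mass gap is NOT proved; no
summit is proved by a line.  Seat ym-line-fcl-p3 g46 (cell ym-idea-1, free hands; item of record ⟨24085⟩ aside, untouched), `--supports stmt-QuantumFields-24197`.
Two `def`s, theorems otherwise; 0 `sorry`; standard axioms; the series' local `ℍ` instances.  References: [cite: Luscher1983, §2]; [folklore].
-/

set_option autoImplicit false
set_option synthInstance.maxSize 1024

noncomputable section

open MeasureTheory Quaternion Set Filter Topology
open scoped Quaternion BigOperators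
open Literature.MathematicalPhysics.QuantumLattice
open Literature.MathematicalPhysics.QuantumFieldTheory hiding SU2
open Summit.QuantumFields.YangMills.Theorems.FemtoTransferGap
open Summit.QuantumFields.YangMills.Theorems.FemtoTransferGap.TT

attribute [local instance] Literature.Analysis.FluidPDE.Tao2016.quatMeasurableSpace
  Literature.Analysis.FluidPDE.Tao2016.quatBorelSpace
  Literature.MathematicalPhysics.QuantumLattice.secondCountableTopology_su2

namespace Summit.QuantumFields.YangMills.Theorems.SwapVirialDeficit.BlowUpRing

variable {L : ℕ} [NeZero L]

/-! ## §1 The deficit in gnomonic coordinates -/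

/-- **THE σ-GLUED DEFICIT IN GNOMONIC COORDINATES**: `F̂_{a,ε}(η) = chartDeficit L z χ (blowUpPoint 1 (gnomonicPoint a ε η))`. [cite: Luscher1983, §2] -/
def gnoDeficit (z : Fin 3 → Bool) (χ : Site 3 L → SU2) (a : ℍ) (ε : GnoSign L) (η : GnoCoord L) : ℝ :=
  chartDeficit L z χ (blowUpPoint 1 (gnomonicPoint a ε η))

/-- **ITS EULER DERIVATIVE** `XF̂ η = d/ds|₀ F̂(eulerDilate eˢ η)` (the flow derivative along the joint blow-up). [folklore] -/
def gnoXDeficit (z : Fin 3 → Bool) (χ : Site 3 L → SU2) (a : ℍ) (ε : GnoSign L) (η : GnoCoord L) : ℝ :=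
  deriv (fun s : ℝ => gnoDeficit z χ a ε (eulerDilate (Real.exp s) η)) 0

/-- The deficit along the flow is the deficit of the blow-up point at scale `t`: `F̂(eulerDilate t η) = chartDeficit (blowUpPoint t (gnomonicPoint a ε η))`
(✓`blowUpPoint_gnomonicPoint`). [folklore] -/
theorem gnoDeficit_eulerDilate (z : Fin 3 → Bool) (χ : Site 3 L → SU2) (a : ℍ) (ε : GnoSign L) (η : GnoCoord L) (t : ℝ) :
    gnoDeficit z χ a ε (eulerDilate t η) = chartDeficit L z χ (blowUpPoint t (gnomonicPoint a ε η)) := by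
  unfold gnoDeficit; rw [← blowUpPoint_gnomonicPoint]

/-- `0 ≤ F̂`. [cite: Luscher1983, §2] -/
theorem gnoDeficit_nonneg (z : Fin 3 → Bool) (χ : Site 3 L → SU2) (a : ℍ) (ε : GnoSign L) (η : GnoCoord L) : 0 ≤ gnoDeficit z χ a ε η :=
  chartDeficit_nonneg z χ _

/-- `F̂` is measurable in `η`. [folklore] -/
theorem measurable_gnoDeficit (z : Fin 3 → Bool) (χ : Site 3 L → SU2) (a : ℍ) (ε : GnoSign L) : Measurable (gnoDeficit (L := L) z χ a ε) :=
  (measurable_chartDeficit z χ).comp ((measurable_blowUpPoint 1).comp (measurable_gnomonicPoint a ε))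

/-! ## §2 The Euler derivative: existence, bound, flow, measurability -/

/-- ★ **S-B restated** (w2 g57's ✓`Gnomonic.hasDerivAt_chartDeficit_gnomonic_le`): for a hub `a ≠ 0`, the flow derivative of `F̂` exists at `s = 0`, it is
`XF̂ η`, and `|XF̂ η| ≤ 324·L⁴`. [cite: Luscher1983, §2] -/
theorem hasDerivAt_gnoDeficit (z : Fin 3 → Bool) (χ : Site 3 L → SU2) {a : ℍ} (ha : a ≠ 0) (ε : GnoSign L) (η : GnoCoord L) :
    HasDerivAt (fun s : ℝ => gnoDeficit z χ a ε (eulerDilate (Real.exp s) η)) (gnoXDeficit z χ a ε η) 0 ∧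
      |gnoXDeficit z χ a ε η| ≤ 324 * (L : ℝ) ^ 4 := by
  obtain ⟨d, hd, hle⟩ := Gnomonic.hasDerivAt_chartDeficit_gnomonic_le z χ ha ε η 0
  have e : (fun s : ℝ => gnoDeficit z χ a ε (eulerDilate (Real.exp s) η)) =
      fun s => chartDeficit L z χ (blowUpPoint (Real.exp s) (gnomonicPoint a ε η)) := funext fun s => gnoDeficit_eulerDilate z χ a ε η _
  have hX : gnoXDeficit z χ a ε η = d := by unfold gnoXDeficit; rw [e]; exact hd.deriv
  rw [hX, e]
  exact ⟨hd, hle⟩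

/-- `|XF̂| ≤ 324·L⁴`. [cite: Luscher1983, §2] -/
theorem abs_gnoXDeficit_le (z : Fin 3 → Bool) (χ : Site 3 L → SU2) {a : ℍ} (ha : a ≠ 0) (ε : GnoSign L) (η : GnoCoord L) :
    |gnoXDeficit z χ a ε η| ≤ 324 * (L : ℝ) ^ 4 :=
  (hasDerivAt_gnoDeficit z χ ha ε η).2

/-- The flow derivative at every `s`: `d/ds F̂(eulerDilate eˢ η) = XF̂(eulerDilate eˢ η)` (✓`hasDerivAt_eulerFlow`). [folklore] -/
theorem hasDerivAt_gnoDeficit_flow (z : Fin 3 → Bool) (χ : Site 3 L → SU2) {a : ℍ} (ha : a ≠ 0) (ε : GnoSign L) (η : GnoCoord L) (s : ℝ) :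
    HasDerivAt (fun s' : ℝ => gnoDeficit z χ a ε (eulerDilate (Real.exp s') η)) (gnoXDeficit z χ a ε (eulerDilate (Real.exp s) η)) s :=
  hasDerivAt_eulerFlow (g := gnoDeficit z χ a ε) (fun η' => (hasDerivAt_gnoDeficit z χ ha ε η').1) η s

/-- ★ **`XF̂` IS MEASURABLE** in `η`: it is the pointwise limit of the measurable difference quotients `(n+1)·(F̂(eulerDilate e^{1/(n+1)} η) − F̂(η))`
(✓`measurable_of_tendsto_metrizable`, ✓`HasDerivAt.tendsto_slope_zero`). [folklore] -/
theorem measurable_gnoXDeficit (z : Fin 3 → Bool) (χ : Site 3 L → SU2) {a : ℍ} (ha : a ≠ 0) (ε : GnoSign L) :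
    Measurable (gnoXDeficit (L := L) z χ a ε) := by
  have hf : ∀ n : ℕ, Measurable fun η : GnoCoord L =>
      ((n : ℝ) + 1) * (gnoDeficit z χ a ε (eulerDilate (Real.exp (1 / ((n : ℝ) + 1))) η) - gnoDeficit z χ a ε η) := fun n =>
    measurable_const.mul (((measurable_gnoDeficit z χ a ε).comp (measurable_eulerDilate _)).sub (measurable_gnoDeficit z χ a ε))
  refine measurable_of_tendsto_metrizable hf ?_
  rw [tendsto_pi_nhds]
  intro η
  have ht := (hasDerivAt_gnoDeficit z χ ha ε η).1.tendsto_slope_zero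
  have hu : Tendsto (fun n : ℕ => (1 : ℝ) / ((n : ℝ) + 1)) atTop (𝓝[≠] (0 : ℝ)) :=
    tendsto_nhdsWithin_iff.2 ⟨tendsto_one_div_add_atTop_nhds_zero_nat, Eventually.of_forall fun n => ne_of_gt (by positivity)⟩
  refine (ht.comp hu).congr fun n => ?_
  simp only [Function.comp_apply, zero_add, Real.exp_zero, eulerDilate_one, one_div, inv_inv, smul_eq_mul]

end Summit.QuantumFields.YangMills.Theorems.SwapVirialDeficit.BlowUpRing

end
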